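import Mathlib
import HarnessLib

/-!
# Stub `stub_separatingCoordinate` (N3a) of line `Sketch`, crux `WeakCouplingHypercubicLimit` (reshape r15)

Helper file for crux `stmt-QuantumFields-16120` (`PencilRigidity.WeakCouplingHypercubicLimit`), line `Sketch`.
Elementary real geometry in `ℝ⁴ = EuclideanSpace ℝ (Fin 4)`: three balls of radius `ρ > 0` around
`p, q, w` whose centres are pairwise at Euclidean distance `≥ 10ρ` are split by a coordinate hyperplane
`{y | y m = c}`: one ball lies strictly on one side (with margin `ρ`), the other two strictly on the other
side.  Proof: `dist p q ^ 2 = ∑ i, (p i - q i) ^ 2` (`EuclideanSpace.dist_sq_eq`), so if every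
coordinate gap `|p i - q i|` were `≤ 4ρ` then `dist p q ≤ 8ρ < 10ρ`; hence some coordinate `m` has
`|p m - q m| > 4ρ`, and a case split on the position of `w m` relative to the nearer endpoint places the
threshold `c` halfway between the isolated centre and the closer of the other two.  Only `0 < ρ` and
`10ρ ≤ dist p q` are used.
-/

noncomputable section

namespace Summit.QuantumFields.YangMills.Theorems.WeakCouplingHypercubicLimit.TraceNormColdPressure

/-- **Coordinate gap.** If `p, q ∈ ℝ⁴` are at Euclidean distance `≥ 10ρ` with `ρ > 0`, then some
coordinate of `p - q` exceeds `4ρ` in absolute value: otherwise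
`dist p q ^ 2 = ∑ i, (p i - q i) ^ 2 ≤ 4 · (4ρ)² = 64ρ² < 100ρ²`. [folklore] -/
theorem exists_coord_abs_sub_gt (p q : EuclideanSpace ℝ (Fin 4)) {ρ : ℝ} (hρ : 0 < ρ)
    (hpq : 10 * ρ ≤ dist p q) : ∃ m : Fin 4, 4 * ρ < |p m - q m| := by
  by_contra hall
  push Not at hall
  have hsq : dist p q ^ 2 = ∑ i, (p i - q i) ^ 2 := by
    rw [EuclideanSpace.dist_sq_eq]
    exact Finset.sum_congr rfl fun i _ => by rw [Real.dist_eq, sq_abs]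
  have hle : ∑ i, (p i - q i) ^ 2 ≤ ∑ _i : Fin 4, (4 * ρ) ^ 2 :=
    Finset.sum_le_sum fun i _ => sq_le_sq' (abs_le.mp (hall i)).1 (abs_le.mp (hall i)).2
  have h4 : ∑ _i : Fin 4, (4 * ρ) ^ 2 = 4 * (4 * ρ) ^ 2 := by simp
  have h10 : (10 * ρ) ^ 2 ≤ dist p q ^ 2 := sq_le_sq' (by linarith [dist_nonneg (x := p) (y := q)]) hpq
  nlinarith [hsq, hle, h4, h10, hρ]

/-- **Stub N3a (separating coordinate).**  For `p, q, w ∈ ℝ⁴` and `ρ > 0` with the three centres pairwise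
at Euclidean distance `≥ 10ρ`, there are a coordinate `m : Fin 4` and a threshold `c : ℝ` such that the
hyperplane `{y | y m = c}` strictly separates, with margin `ρ` on both sides, one of the three points from
the other two (the six disjuncts record which point is isolated and on which side).  By the coordinate gap
lemma some `m` has `|p m - q m| > 4ρ`; say `p m + 4ρ < q m` (the other sign is symmetric).  If
`w m > p m + 2ρ` then `p` is isolated below with `c = (p m + min (q m) (w m)) / 2`; otherwise
`w m ≤ p m + 2ρ < q m - 2ρ` and `q` is isolated above with `c = (max (p m) (w m) + q m) / 2`.  Only the
hypotheses `0 < ρ` and `10ρ ≤ dist p q` are used. [folklore] -/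
theorem stub_separatingCoordinate :
    ∀ (p q w : EuclideanSpace ℝ (Fin 4)) (ρ : ℝ), 0 < ρ → 10 * ρ ≤ dist p q → 10 * ρ ≤ dist p w → 10 * ρ ≤ dist q w →
      ∃ (m : Fin 4) (c : ℝ),
        (p m + ρ < c ∧ c + ρ < q m ∧ c + ρ < w m) ∨ (c + ρ < p m ∧ q m + ρ < c ∧ w m + ρ < c) ∨
        (q m + ρ < c ∧ c + ρ < p m ∧ c + ρ < w m) ∨ (c + ρ < q m ∧ p m + ρ < c ∧ w m + ρ < c) ∨
        (w m + ρ < c ∧ c + ρ < p m ∧ c + ρ < q m) ∨ (c + ρ < w m ∧ p m + ρ < c ∧ q m + ρ < c) := by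
  intro p q w ρ hρ hpq _ _
  obtain ⟨m, hm⟩ := exists_coord_abs_sub_gt p q hρ hpq
  rcases lt_abs.mp hm with h | h
  · -- `q m + 4ρ < p m`
    by_cases hw : q m + 2 * ρ < w m
    · -- `q` is isolated below `p` and `w` (third disjunct)
      refine ⟨m, (q m + min (p m) (w m)) / 2, Or.inr (Or.inr (Or.inl ⟨?_, ?_, ?_⟩))⟩
      · have := lt_min (show q m + 2 * ρ < p m by linarith) hw
        linarith
      · have := min_le_left (p m) (w m)
        linarith
      · have := min_le_right (p m) (w m)
        linarith
    · -- `p` is isolated above `q` and `w` (second disjunct)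
      push Not at hw
      refine ⟨m, (max (q m) (w m) + p m) / 2, Or.inr (Or.inl ⟨?_, ?_, ?_⟩)⟩
      · have := max_lt (show q m < p m - 2 * ρ by linarith) (show w m < p m - 2 * ρ by linarith)
        linarith
      · have := le_max_left (q m) (w m)
        linarith
      · have := le_max_right (q m) (w m)
        linarith
  · -- `p m + 4ρ < q m`
    by_cases hw : p m + 2 * ρ < w m
    · -- `p` is isolated below `q` and `w` (first disjunct)
      refine ⟨m, (p m + min (q m) (w m)) / 2, Or.inl ⟨?_, ?_, ?_⟩⟩
      · have := lt_min (show p m + 2 * ρ < q m by linarith) hw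
        linarith
      · have := min_le_left (q m) (w m)
        linarith
      · have := min_le_right (q m) (w m)
        linarith
    · -- `q` is isolated above `p` and `w` (fourth disjunct)
      push Not at hw
      refine ⟨m, (max (p m) (w m) + q m) / 2, Or.inr (Or.inr (Or.inr (Or.inl ⟨?_, ?_, ?_⟩)))⟩
      · have := max_lt (show p m < q m - 2 * ρ by linarith) (show w m < q m - 2 * ρ by linarith)
        linarith
      · have := le_max_left (p m) (w m)
        linarith
      · have := le_max_right (p m) (w m)
        linarith

end Summit.QuantumFields.YangMills.Theorems.WeakCouplingHypercubicLimit.TraceNormColdPressure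

end
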